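import Summits.ABC.StewartYu.PadicG3TwoBudgetZ
import HarnessLib

/-!
# Cell abc-stewartyu, Gen-3 frame at `p = 2` (crux `Y07Two`, stmt-ABC-19659), record: the k-step BUDGET LINES
# (L2₀)/(L2) of the schedule of record `schedTwoS` — the gain branches `Bw/(4·2^m)^{gain} < 1/KTwo` from the
# parameter ledger `PadicG3Par`

`Summits/ABC/StewartYu/PadicG3TwoBudgetK.lean` — cell `abc-stewartyu` (HOME `run/shared/lean/pub/abc-stewartyu/`),
route `PadicPrimesKummerThird`, seat p3 (g6, F-two lead).  Theorems only (real arithmetic).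

THE COMPARISON (unit `Z = G·X·L`, `G = (m+2)·log 2` = the slab gain per zero at `p = 2`; `n = d + 1 ≥ 2`).
COST of a k-step at level `I ≤ I*`, point `|x₁| ≤ 3^{k+1}·Xs3 I`, multi-index of total order `≤ T03 0`:
`log Bw3 + log KTwo ≤ (17/4)·Z + FH` where every slot is bounded in `P`-letters (`PadicG3TwoSizes`,
`PadicG3TwoScheduleArith`): weights `L₀(G + log 2) ≤ Z/8 + …`, `2·log #box ≤ Z/16 + 2`, the pre-scaled Fel'dman
sizes twice (Siegel level and step level) `log feldSize ≤ (7/5)·Z` each (`T03 0·I*·log 3 ≤ (4/5)Z`,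
`T03 0·log ν(H) ≤ Z/4`, the `Y₀`-line `L₀·(1 + log(1 + 3^{I*−I}|x|/H)) ≤ Z/3`), the directional lines
`T03 0·log Xb3R ≤ (5/16)Z` twice, the level-`0` far height `4X·hbox0 ≤ Z/2`, and the step's far height
`FH = 4|x₁|·hboxR I ≤ (3/2)·3ᵏ·Z` (`I = 0`) resp. `3·3ᵏ·Z` (`I ≥ 1`, shrinking boxes).  GAIN: level `0` (all nodes,
`gainExpA`): `(2X+1)·4L·G ≥ 8Z` (`k = 0`), `≥ (248/33)·3ᵏ·Z` (`k ≥ 1`); levels `I ≥ 1` (`gainExp`): `4·Xs3·T3·G ≥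
(247/18)·Z` (`k = 0`, coprime nodes), `≥ (247/36)·3ᵏ·Z` (`k ≥ 1`).  Hence **`hL2zero_gain_schedTwoS`** and
**`hL2_gain_schedTwoS`** — the gain branches of `frameNumericsTwoRA_schedTwoS`'s (L2₀)/(L2), for every datum
whose record is the `p = 2` ledger (`G = (m+2)·log 2`, `2G ≤ yload`, heights `h(αⱼ) ≤ Aⱼ`, `h(θ) ≤ A_θ`,
coefficients `|bⱼ|, |b_θ| ≤ e^W`, floor `Aⱼ ≥ 1`).

WHAT THIS IS NOT: the `‖Λ₀‖`-branches (`PadicG3TwoFirstBranch`), the third step (L3), the END; no crux moves.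

References: Yu. V. Nesterenko, LNM 1819 (2003), §4.2 (4.24)–(4.35), Cor. 4.5; K. Yu, Acta Math. 211 (2013),
Lemma 5.2 (5.28)–(5.41); HOME/p1/K-M3-1-padic-ledger.md §4 (B3).
-/

noncomputable section

open Finset Real
open Literature.NumberTheory.Transcendental
open Literature.NumberTheory.Transcendental.CW77.Setup (Tau tauNorm)

namespace Summit.ABC.StewartYu

namespace TwoSetup

open Summit.ABC.StewartYu.G3Boxes Summit.ABC.StewartYu.PadicG3Par

variable (S : TwoSetup) (P : PadicG3Par (S.d + 1))

/-! ### The far-height terms -/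

/-- `hboxR 0 = hbox0`. [folklore] -/
theorem hboxR_zero : S.hboxR P 0 = S.hbox0 P := by
  unfold hboxR hbox0; rw [S.Dbox3R_zero P, S.Dθ3R_zero P]

/-- **Far height at level `0`**: `4|x|·hboxR 0 ≤ (3/2)·3ᵏ·Z` for `|x| ≤ 3^{k+1}·Xs3 0`.
[cite: Nesterenko2003, §4.2 (4.26); shape only] -/
theorem fh_zero_le (hα : ∀ j, Height.logHeight₁ (S.α j) ≤ P.A (Fin.castSucc j))
    (hθ : Height.logHeight₁ S.θ ≤ P.A (Fin.last S.d)) {k : ℕ} {x : ℤ}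
    (hx : |x| ≤ ((3 ^ (k + 1) * S.Xs3 P 0 : ℕ) : ℤ)) :
    4 * |(x : ℝ)| * S.hboxR P 0 ≤ (3 / 2) * (3 : ℝ) ^ k * (P.G * P.X * P.L) := by
  obtain ⟨hX36, hG8, hL25, hLG, hLL, hLH, hXL⟩ := S.base_facts P
  rw [S.hboxR_zero P]
  have hh := S.hbox0_le P hα hθ
  have hh0 := S.hbox0_nonneg P
  have hXs := S.Xs3_zero_le P
  have hx' : |(x : ℝ)| ≤ (3 : ℝ) ^ (k + 1) * (S.Xs3 P 0 : ℝ) := by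
    have : ((|x| : ℤ) : ℝ) ≤ (((3 ^ (k + 1) * S.Xs3 P 0 : ℕ) : ℤ) : ℝ) := by exact_mod_cast hx
    push_cast at this; exact this
  have hX0 : (0 : ℝ) ≤ P.X := by positivity
  have hL0 : (0 : ℝ) ≤ P.L := by positivity
  have h3 : (0 : ℝ) ≤ (3 : ℝ) ^ (k + 1) := by positivity
  have h1 : |(x : ℝ)| ≤ (3 : ℝ) ^ (k + 1) * P.X := hx'.trans (mul_le_mul_of_nonneg_left hXs h3)
  have hd : ((S.d : ℝ) + 1) * P.L ≤ ((S.d : ℝ) + 1 + 1) * P.L := by nlinarith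
  calc 4 * |(x : ℝ)| * S.hbox0 P ≤ 4 * ((3 : ℝ) ^ (k + 1) * P.X) * (((S.d : ℝ) + 1 + 1) * P.L) :=
        mul_le_mul (mul_le_mul_of_nonneg_left h1 (by norm_num)) (hh.trans hd) hh0 (by positivity)
    _ = (3 / 2) * (3 : ℝ) ^ k * (8 * ((S.d : ℝ) + 1 + 1) * (P.X * P.L)) := by rw [pow_succ]; ring
    _ ≤ (3 / 2) * (3 : ℝ) ^ k * (P.G * P.X * P.L) := mul_le_mul_of_nonneg_left hXL (by positivity)

/-- **Far height at level `I ≥ 1`** (shrinking boxes): `4|x|·hboxR I ≤ 3·3ᵏ·Z` for `|x| ≤ 3^{k+1}·Xs3 I`.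
[cite: Nesterenko2003, §4.3 (4.35); shape only] -/
theorem fh_pos_le (hα : ∀ j, Height.logHeight₁ (S.α j) ≤ P.A (Fin.castSucc j))
    (hθ : Height.logHeight₁ S.θ ≤ P.A (Fin.last S.d)) {I : ℕ} (hI : 1 ≤ I) {k : ℕ} {x : ℤ}
    (hx : |x| ≤ ((3 ^ (k + 1) * S.Xs3 P I : ℕ) : ℤ)) :
    4 * |(x : ℝ)| * S.hboxR P I ≤ 3 * (3 : ℝ) ^ k * (P.G * P.X * P.L) := by
  obtain ⟨hX36, hG8, hL25, hLG, hLL, hLH, hXL⟩ := S.base_facts P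
  have hh := S.hboxR_le_L P hI hα hθ
  have hh0 : 0 ≤ S.hboxR P I := by
    unfold hboxR
    have : ∀ j, 0 ≤ Height.logHeight₁ (S.α j) := fun j => Height.zero_le_logHeight₁ _
    have hθ0 : 0 ≤ Height.logHeight₁ S.θ := Height.zero_le_logHeight₁ _
    positivity
  have hXs := (S.Xs3_lt P I).le
  have hx' : |(x : ℝ)| ≤ (3 : ℝ) ^ (k + 1) * (S.Xs3 P I : ℝ) := by
    have : ((|x| : ℤ) : ℝ) ≤ (((3 ^ (k + 1) * S.Xs3 P I : ℕ) : ℤ) : ℝ) := by exact_mod_cast hx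
    push_cast at this; exact this
  have hX0 : (0 : ℝ) ≤ P.X := by positivity
  have hL0 : (0 : ℝ) ≤ P.L := by positivity
  have h3 : (0 : ℝ) < (3 : ℝ) ^ I := by positivity
  have h1 : |(x : ℝ)| ≤ (3 : ℝ) ^ (k + 1) * ((3 : ℝ) ^ I * P.X) :=
    hx'.trans (mul_le_mul_of_nonneg_left hXs (by positivity))
  calc 4 * |(x : ℝ)| * S.hboxR P I
      ≤ 4 * ((3 : ℝ) ^ (k + 1) * ((3 : ℝ) ^ I * P.X)) * (2 * ((S.d : ℝ) + 1) * P.L / (3 : ℝ) ^ I) :=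
        mul_le_mul (mul_le_mul_of_nonneg_left h1 (by norm_num)) hh hh0 (by positivity)
    _ = 3 * (3 : ℝ) ^ k * (8 * ((S.d : ℝ) + 1) * (P.X * P.L)) := by
        rw [pow_succ]; field_simp; ring
    _ ≤ 3 * (3 : ℝ) ^ k * (8 * ((S.d : ℝ) + 1 + 1) * (P.X * P.L)) := by
        have : 8 * ((S.d : ℝ) + 1) * (P.X * P.L) ≤ 8 * ((S.d : ℝ) + 1 + 1) * (P.X * P.L) := by nlinarith
        exact mul_le_mul_of_nonneg_left this (by positivity)
    _ ≤ 3 * (3 : ℝ) ^ k * (P.G * P.X * P.L) := mul_le_mul_of_nonneg_left hXL (by positivity)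

/-! ### The cost of a k-step -/

/-- Small terms: `G ≤ Z/2^30`, `n+1 ≤ Z/2^30`, `1 ≤ Z/2^30`. [folklore] -/
theorem smalls_le_Z :
    P.G ≤ P.G * P.X * P.L / 2 ^ 30 ∧ ((S.d : ℝ) + 1 + 1) ≤ P.G * P.X * P.L / 2 ^ 30 ∧
      (1 : ℝ) ≤ P.G * P.X * P.L / 2 ^ 30 := by
  obtain ⟨hX36, hG8, hL25, hLG, hLL, hLH, hXL⟩ := S.base_facts P
  set Z : ℝ := P.G * P.X * P.L with hZ
  set N1 : ℝ := (S.d : ℝ) + 1 + 1 with hN1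
  have hd0 : (0 : ℝ) ≤ (S.d : ℝ) := by positivity
  have hN1' : 2 ≤ N1 := by rw [hN1]; linarith
  have hGpos : 0 < P.G := by linarith [P.eight_le_G]
  have hNL : (2 : ℝ) * 2 ^ 25 ≤ N1 * P.L := mul_le_mul hN1' hL25 (by positivity) (by linarith)
  refine ⟨?_, ?_, ?_⟩
  · have h1 : (2 : ℝ) ^ 30 ≤ 36 * N1 * P.L := by
      have e : (36 : ℝ) * N1 * P.L = 36 * (N1 * P.L) := by ring
      rw [e]; norm_num at hNL ⊢; linarith
    have h2 : P.G * 2 ^ 30 ≤ P.G * (36 * N1 * P.L) := mul_le_mul_of_nonneg_left h1 hGpos.le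
    have e : P.G * (36 * N1 * P.L) = 36 * N1 * (P.L * P.G) := by ring
    rw [le_div_iff₀ (by positivity)]; linarith
  · have h30 : (2 : ℝ) ^ 30 ≤ 288 * N1 * P.L := by
      have e : (288 : ℝ) * N1 * P.L = 288 * (N1 * P.L) := by ring
      rw [e]; norm_num at hNL ⊢; linarith
    have h31 : N1 * 2 ^ 30 ≤ N1 * (288 * N1 * P.L) := mul_le_mul_of_nonneg_left h30 (by linarith)
    have e : N1 * (288 * N1 * P.L) = 288 * N1 ^ 2 * P.L := by ring
    rw [le_div_iff₀ (by positivity)]; linarith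
  · rw [le_div_iff₀ (by positivity), hZ]; have := P.GXL_ge; nlinarith

/-- **The level-`0` Siegel size**: `log Amax3 ≤ (177/80)·Z + G + 13(n+1) + log 2`.
[cite: Yu2013, (4.28); shape only] -/
theorem log_Amax3_le_Z (hG : P.G = (P.m + 2) * Real.log 2) (hy : 2 * P.G ≤ P.yload) (hA1 : ∀ j, 1 ≤ P.A j)
    (hα : ∀ j, Height.logHeight₁ (S.α j) ≤ P.A (Fin.castSucc j)) (hθ : Height.logHeight₁ S.θ ≤ P.A (Fin.last S.d))
    (hb : ∀ j, |(S.b j : ℝ)| ≤ Real.exp P.W) (hbθ : |(S.bθ : ℝ)| ≤ Real.exp P.W) :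
    Real.log (S.Amax3 P (S.one_le_T03 P 0)) ≤
      (177 / 80) * (P.G * P.X * P.L) + P.G + 13 * ((S.d : ℝ) + 1 + 1) + Real.log 2 := by
  obtain ⟨hX36, hG8, hL25, hLG, hLL, hLH, hXL⟩ := S.base_facts P
  have hAmax := S.log_Amax3_le P
  have hM₀E := S.log_M₀E3_le P
  have hX9 := P.X_le_nine_H
  -- the level-`0` Fel'dman size
  have hF0 : Real.log (S.feldSize P 0 P.X (S.T03 P 0)) ≤
      (7 / 5) * (P.G * P.X * P.L) + P.G + 13 * ((S.d : ℝ) + 1 + 1) := by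
    refine S.log_feldSize_le_Z P hG hy 0 (by positivity) (k := 0) (by omega) ?_ le_rfl
    rw [Nat.sub_zero, pow_zero, mul_one]
    have h3 : (0 : ℝ) ≤ (3 : ℝ) ^ S.Istar3 P := by positivity
    calc (3 : ℝ) ^ S.Istar3 P * (P.X : ℝ) ≤ (3 : ℝ) ^ S.Istar3 P * (9 * P.H) := mul_le_mul_of_nonneg_left hX9 h3
      _ = 9 * (3 : ℝ) ^ S.Istar3 P * P.H := by ring
  -- the directional line at level `0`
  have hXb0 : (S.T03 P 0 : ℝ) * Real.log (S.Xb3 P 0 : ℝ) ≤ (5 / 16) * (P.G * P.X * P.L) := by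
    rw [← S.Xb3R_zero P]; exact S.mul_log_Xb3R_le_Z P hA1 hb hbθ 0 le_rfl
  -- the far height at level `0`
  have hhb0 : 4 * (P.X : ℝ) * S.hbox0 P ≤ (P.G * P.X * P.L) / 2 := by
    have hh := S.hbox0_le P hα hθ
    have hL0 : (0 : ℝ) ≤ P.L := by positivity
    have hd : ((S.d : ℝ) + 1) * P.L ≤ ((S.d : ℝ) + 1 + 1) * P.L := by nlinarith
    have h1 : 4 * (P.X : ℝ) * S.hbox0 P ≤ 4 * (P.X : ℝ) * (((S.d : ℝ) + 1 + 1) * P.L) :=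
      mul_le_mul_of_nonneg_left (hh.trans hd) (by positivity)
    have e : 4 * (P.X : ℝ) * (((S.d : ℝ) + 1 + 1) * P.L) = (8 * ((S.d : ℝ) + 1 + 1) * (P.X * P.L)) / 2 := by ring
    rw [e] at h1
    linarith
  linarith

/-- **THE COST OF A k-STEP**: `log Bw3 + log KTwo I x τ ≤ (83/20)·Z + 4|x|·hboxR I` for `I ≤ I*`, `k < d + 3`,
`|x| ≤ 3^{k+1}·Xs3 I`, `tauNorm τ ≤ T03 0`. [cite: Nesterenko2003, §4.2 (4.24)–(4.35); shape only] -/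
theorem cost_le (hG : P.G = (P.m + 2) * Real.log 2) (hy : 2 * P.G ≤ P.yload) (hA1 : ∀ j, 1 ≤ P.A j)
    (hα : ∀ j, Height.logHeight₁ (S.α j) ≤ P.A (Fin.castSucc j)) (hθ : Height.logHeight₁ S.θ ≤ P.A (Fin.last S.d))
    (hb : ∀ j, |(S.b j : ℝ)| ≤ Real.exp P.W) (hbθ : |(S.bθ : ℝ)| ≤ Real.exp P.W)
    {I : ℕ} (hI : I ≤ S.Istar3 P) {k : ℕ} (hk : k < S.d + 3) {x : ℤ}
    (hx : |x| ≤ ((3 ^ (k + 1) * S.Xs3 P I : ℕ) : ℤ)) {τ : Tau S.d} (hτ : tauNorm τ ≤ S.T03 P 0) :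
    Real.log (S.Bw3 P) + Real.log (KTwo (S.schedTwoS P) I x τ) ≤
      (83 / 20) * (P.G * P.X * P.L) + 4 * |(x : ℝ)| * S.hboxR P I := by
  obtain ⟨hGZ, hNZ, h1Z⟩ := S.smalls_le_Z P
  have hX9 := P.X_le_nine_H
  -- the slots
  have hK := S.log_KTwo_schedTwoS_le P I x τ
  have hBw := S.log_Bw3_le_Z P hG hy
  have hc0 := S.log_cardB_le_lunk P hA1 0
  have hcI := S.log_cardB_le_lunk P hA1 I
  have hlunk := P.lunk_le
  have hAmax := S.log_Amax3_le_Z P hG hy hA1 hα hθ hb hbθ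
  -- order bounds of the multi-index
  have ht1 : τ.1 ≤ S.T03 P 0 := le_trans (by unfold tauNorm; omega) hτ
  have ht2 : ((∑ j, τ.2 j : ℕ) : ℝ) ≤ S.T03 P 0 := by
    have : ∑ j, τ.2 j ≤ S.T03 P 0 := le_trans (by unfold tauNorm; omega) hτ
    exact_mod_cast this
  -- the step's Fel'dman size at `r = |x| ≤ 3^{k+1}·3^I·X ≤ 3^{k+1}·3^I·9H`
  have hx' : |(x : ℝ)| ≤ (3 : ℝ) ^ (k + 1) * (S.Xs3 P I : ℝ) := by
    have : ((|x| : ℤ) : ℝ) ≤ (((3 ^ (k + 1) * S.Xs3 P I : ℕ) : ℤ) : ℝ) := by exact_mod_cast hx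
    push_cast at this; exact this
  have hFI : Real.log (S.feldSize P I |(x : ℝ)| τ.1) ≤
      (7 / 5) * (P.G * P.X * P.L) + P.G + 13 * ((S.d : ℝ) + 1 + 1) := by
    refine S.log_feldSize_le_Z P hG hy I (abs_nonneg _) (k := k + 1) (by omega) ?_ ht1
    have hXs := (S.Xs3_lt P I).le
    have h3I : (0 : ℝ) ≤ (3 : ℝ) ^ (S.Istar3 P - I) := by positivity
    have h1 : |(x : ℝ)| ≤ (3 : ℝ) ^ (k + 1) * ((3 : ℝ) ^ I * (9 * P.H)) :=
      hx'.trans (mul_le_mul_of_nonneg_left (hXs.trans (mul_le_mul_of_nonneg_left hX9 (by positivity)))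
        (by positivity))
    have e3 : (3 : ℝ) ^ (S.Istar3 P - I) * (3 : ℝ) ^ I = (3 : ℝ) ^ S.Istar3 P := by
      rw [← pow_add, Nat.sub_add_cancel hI]
    have e : (3 : ℝ) ^ (S.Istar3 P - I) * ((3 : ℝ) ^ (k + 1) * ((3 : ℝ) ^ I * (9 * P.H))) =
        9 * (3 : ℝ) ^ S.Istar3 P * (3 : ℝ) ^ (k + 1) * P.H := by
      calc (3 : ℝ) ^ (S.Istar3 P - I) * ((3 : ℝ) ^ (k + 1) * ((3 : ℝ) ^ I * (9 * P.H)))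
          = ((3 : ℝ) ^ (S.Istar3 P - I) * (3 : ℝ) ^ I) * (3 : ℝ) ^ (k + 1) * (9 * P.H) := by ring
        _ = 9 * (3 : ℝ) ^ S.Istar3 P * (3 : ℝ) ^ (k + 1) * P.H := by rw [e3]; ring
    rw [← e]
    exact mul_le_mul_of_nonneg_left h1 h3I
  -- the directional line of the step
  have hXbI : ((∑ j, τ.2 j : ℕ) : ℝ) * Real.log (S.Xb3R P I : ℝ) ≤ (5 / 16) * (P.G * P.X * P.L) :=
    S.mul_log_Xb3R_le_Z P hA1 hb hbθ I ht2
  have hlog2 := log_two_le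
  -- assemble
  linarith only [hK, hBw, hc0, hcI, hlunk, hAmax, hFI, hXbI, hGZ, hNZ, h1Z, hlog2]

/-! ### The gains -/

/-- `log (4·2^m) = G` for the `p = 2` ledger. [folklore] -/
theorem log_rho_eq_G (hG : P.G = (P.m + 2) * Real.log 2) : Real.log (4 * (2 : ℝ) ^ P.m) = P.G := by
  rw [hG, show (4 : ℝ) * 2 ^ P.m = 2 ^ (P.m + 2) by rw [pow_add]; norm_num; ring, Real.log_pow]
  push_cast; ring

/-- **Gain at level `0`** (all nodes): `gainExpA σ 0 k · G ≥ 8Z` (`k = 0`), `≥ (248/33)·3ᵏ·Z` (`k ≥ 1`); in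
particular `≥ min`-free form `gainExpA·G ≥ (15/2)·3ᵏ·Z`. [cite: Nesterenko2003, §4 (4.3); shape only] -/
theorem gainA_ge (k : ℕ) :
    (15 / 2) * (3 : ℝ) ^ k * (P.G * P.X * P.L) ≤ (gainExpA (S.schedTwoS P) 0 k : ℝ) * P.G := by
  obtain ⟨hX36, hG8, hL25, hLG, hLL, hLH, hXL⟩ := S.base_facts P
  have hGpos : 0 < P.G := by linarith [P.eight_le_G]
  have hT : S.T3 P 0 = 4 * P.L := by unfold T3; simp
  unfold gainExpA
  rw [schedTwoS_Nsub, schedTwoS_tdec, hT]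
  have hX0 : (0 : ℝ) ≤ P.X := by positivity
  have hL0 : (0 : ℝ) ≤ P.L := by positivity
  rcases Nat.eq_zero_or_pos k with rfl | hk
  · rw [Nsub3_zero_zero]; push_cast; nlinarith
  · have hN : S.Nsub3 P 0 k = 3 ^ k * S.Xs3 P 0 := by unfold Nsub3; rw [if_neg (by omega)]
    rw [hN]; push_cast
    have hXs := S.Xs3_zero_ge P
    have h3 : (0 : ℝ) ≤ (3 : ℝ) ^ k := by positivity
    have h1 : (3 : ℝ) ^ k * ((31 / 33) * P.X) ≤ (3 : ℝ) ^ k * (S.Xs3 P 0 : ℝ) := mul_le_mul_of_nonneg_left hXs h3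
    have h2 : (15 / 2) * (3 : ℝ) ^ k * (P.G * P.X * P.L) ≤ 8 * ((3 : ℝ) ^ k * ((31 / 33) * P.X)) * P.L * P.G := by
      nlinarith [mul_nonneg (mul_nonneg h3 hX0) (mul_nonneg hL0 hGpos.le)]
    nlinarith [mul_nonneg h3 hX0, mul_nonneg hL0 hGpos.le, mul_nonneg (mul_nonneg h3 (by positivity : (0:ℝ) ≤ S.Xs3 P 0)) (mul_nonneg hL0 hGpos.le)]

/-- **Gain at level `I ≥ 1`**: `gainExp σ I k · G ≥ (247/18)·Z` (`k = 0`, coprime nodes `3·Xs3 − Xs3`),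
`≥ (247/36)·3ᵏ·Z` (`k ≥ 1`). [cite: Yu2013, Lemma 5.2 (5.27); shape only] -/
theorem gain_ge {I : ℕ} (hI : 1 ≤ I) (hT8 : 8 ≤ S.T3 P I) (k : ℕ) :
    (if k = 0 then (247 / 18 : ℝ) else (247 / 36) * (3 : ℝ) ^ k) * (P.G * P.X * P.L) ≤
      (gainExp (S.schedTwoS P) I k : ℝ) * P.G := by
  have hGpos : 0 < P.G := by linarith [P.eight_le_G]
  have hXT := S.Xs3_mul_T3_ge P I hT8
  have hI0 : I ≠ 0 := by omega
  unfold gainExp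
  rw [schedTwoS_Nsub, schedTwoS_tdec]
  rcases Nat.eq_zero_or_pos k with rfl | hk
  · simp only [if_true]
    have hN : S.Nsub3 P I 0 = 3 * S.Xs3 P I := by unfold Nsub3; simp [hI0]
    rw [hN, Nat.mul_div_cancel_left _ (by norm_num : 0 < 3)]
    have e : (2 * (3 * S.Xs3 P I - S.Xs3 P I) * S.T3 P I : ℕ) = 4 * (S.Xs3 P I * S.T3 P I) := by
      rw [show 3 * S.Xs3 P I - S.Xs3 P I = 2 * S.Xs3 P I by omega]; ring
    rw [e]; push_cast
    nlinarith
  · rw [if_neg (by omega), if_neg (by omega)]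
    have hN : S.Nsub3 P I k = 3 ^ k * S.Xs3 P I := by unfold Nsub3; rw [if_neg (by omega)]
    rw [hN]; push_cast
    have h3 : (0 : ℝ) ≤ (3 : ℝ) ^ k := by positivity
    have hX0 : (0 : ℝ) ≤ (S.Xs3 P I : ℝ) := by positivity
    have hT0 : (0 : ℝ) ≤ (S.T3 P I : ℝ) := by positivity
    have h1 : (3 : ℝ) ^ k * ((247 / 72) * P.X * P.L) ≤ (3 : ℝ) ^ k * ((S.Xs3 P I : ℝ) * (S.T3 P I : ℝ)) :=
      mul_le_mul_of_nonneg_left hXT h3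
    nlinarith [mul_nonneg (mul_nonneg h3 (mul_nonneg hX0 hT0)) hGpos.le, mul_nonneg hT0 hGpos.le]

/-! ### The budget lines -/

/-- **(L2₀) THE k-STEP GAIN BRANCHES AT LEVEL `0`** (all nodes; budget `≥ (15/2)·3ᵏ·Z` against cost
`≤ (83/20)·Z + (3/2)·3ᵏ·Z`). [cite: Nesterenko2003, §4.2 Cor 4.5] [cite: Yu2013, Lemma 5.2 (5.28)–(5.31)] -/
theorem hL2zero_gain_schedTwoS (hG : P.G = (P.m + 2) * Real.log 2) (hy : 2 * P.G ≤ P.yload)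
    (hA1 : ∀ j, 1 ≤ P.A j)
    (hα : ∀ j, Height.logHeight₁ (S.α j) ≤ P.A (Fin.castSucc j)) (hθ : Height.logHeight₁ S.θ ≤ P.A (Fin.last S.d))
    (hb : ∀ j, |(S.b j : ℝ)| ≤ Real.exp P.W) (hbθ : |(S.bθ : ℝ)| ≤ Real.exp P.W) :
    ∀ k, k < (S.schedTwoS P).kst 0 → ∀ x₁ : ℤ, |x₁| ≤ ((S.schedTwoS P).Nsub 0 (k + 1) : ℤ) →
      ∀ τ : Tau S.d, tauNorm τ + (S.schedTwoS P).tdec 0 ≤ (S.schedTwoS P).T0 0 - k * (S.schedTwoS P).tdec 0 →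
      (S.schedTwoS P).Bw 0 / (4 * (2 : ℝ) ^ (S.schedTwoS P).m) ^ gainExpA (S.schedTwoS P) 0 k <
        1 / KTwo (S.schedTwoS P) 0 x₁ τ := by
  intro k hk x₁ hx₁ τ hτ
  rw [schedTwoS_kst] at hk
  rw [schedTwoS_Nsub] at hx₁
  rw [schedTwoS_tdec, schedTwoS_T0] at hτ
  rw [schedTwoS_Bw, schedTwoS_m]
  have hNs : S.Nsub3 P 0 (k + 1) = 3 ^ (k + 1) * S.Xs3 P 0 := by unfold Nsub3; rw [if_neg (by omega)]
  rw [hNs] at hx₁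
  have hτ' : tauNorm τ ≤ S.T03 P 0 := by omega
  refine branch_gain_lt_of_log (S.Bw3_pos P) (S.KTwo_schedTwoS_pos P 0 x₁ τ) (by positivity) ?_
  rw [S.log_rho_eq_G P hG]
  have hc := S.cost_le P hG hy hA1 hα hθ hb hbθ (Nat.zero_le _) hk hx₁ hτ'
  have hf := S.fh_zero_le P hα hθ hx₁
  have hg := S.gainA_ge P k
  have hZ : (0 : ℝ) < P.G * P.X * P.L := by have := P.GXL_ge; linarith [show (0:ℝ) < 16*72*2^25 by positivity]
  have h3 : (1 : ℝ) ≤ (3 : ℝ) ^ k := one_le_pow₀ (by norm_num)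
  nlinarith

/-- **(L2) THE k-STEP GAIN BRANCHES AT LEVELS `1 ≤ I ≤ I*`** (coprime first sub-step; budget `≥ (247/18)·Z` resp.
`(247/36)·3ᵏ·Z` against cost `≤ (83/20)·Z + 3·3ᵏ·Z`), given the depth fit `8·3^{I*} ≤ 4L`.
[cite: Nesterenko2003, §4.2 Cor 4.5] [cite: Yu2013, Lemma 5.2 (5.28)–(5.31)] -/
theorem hL2_gain_schedTwoS (hG : P.G = (P.m + 2) * Real.log 2) (hy : 2 * P.G ≤ P.yload)
    (hA1 : ∀ j, 1 ≤ P.A j)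
    (hα : ∀ j, Height.logHeight₁ (S.α j) ≤ P.A (Fin.castSucc j)) (hθ : Height.logHeight₁ S.θ ≤ P.A (Fin.last S.d))
    (hb : ∀ j, |(S.b j : ℝ)| ≤ Real.exp P.W) (hbθ : |(S.bθ : ℝ)| ≤ Real.exp P.W)
    (hdepth : 8 * 3 ^ S.Istar3 P ≤ 4 * P.L) :
    ∀ I, 1 ≤ I → I ≤ S.Istar3 P → ∀ k, k < (S.schedTwoS P).kst I → ∀ x₁ : ℤ,
      |x₁| ≤ ((S.schedTwoS P).Nsub I (k + 1) : ℤ) →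
      ∀ τ : Tau S.d, tauNorm τ + (S.schedTwoS P).tdec I ≤ (S.schedTwoS P).T0 I - k * (S.schedTwoS P).tdec I →
      (S.schedTwoS P).Bw I / (4 * (2 : ℝ) ^ (S.schedTwoS P).m) ^ gainExp (S.schedTwoS P) I k <
        1 / KTwo (S.schedTwoS P) I x₁ τ := by
  intro I hI1 hI k hk x₁ hx₁ τ hτ
  rw [schedTwoS_kst] at hk
  rw [schedTwoS_Nsub] at hx₁
  rw [schedTwoS_tdec, schedTwoS_T0] at hτ
  rw [schedTwoS_Bw, schedTwoS_m]
  have hNs : S.Nsub3 P I (k + 1) = 3 ^ (k + 1) * S.Xs3 P I := by unfold Nsub3; rw [if_neg (by omega)]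
  rw [hNs] at hx₁
  have hτ' : tauNorm τ ≤ S.T03 P 0 := le_trans (by omega) (S.T03_le_T03_zero P I)
  have hT8 : 8 ≤ S.T3 P I := S.T3_ge_of_depth P hdepth hI
  refine branch_gain_lt_of_log (S.Bw3_pos P) (S.KTwo_schedTwoS_pos P I x₁ τ) (by positivity) ?_
  rw [S.log_rho_eq_G P hG]
  have hc := S.cost_le P hG hy hA1 hα hθ hb hbθ hI hk hx₁ hτ'
  have hf := S.fh_pos_le P hα hθ hI1 hx₁
  have hg := S.gain_ge P hI1 hT8 k
  have hZ : (0 : ℝ) < P.G * P.X * P.L := by have := P.GXL_ge; linarith [show (0:ℝ) < 16*72*2^25 by positivity]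
  have h3 : (1 : ℝ) ≤ (3 : ℝ) ^ k := one_le_pow₀ (by norm_num)
  rcases Nat.eq_zero_or_pos k with rfl | hk0
  · simp only [if_true, pow_zero] at hg hf
    linarith
  · rw [if_neg (by omega)] at hg
    have h33 : (3 : ℝ) ≤ (3 : ℝ) ^ k := by
      calc (3 : ℝ) = 3 ^ 1 := by norm_num
        _ ≤ 3 ^ k := pow_le_pow_right₀ (by norm_num) hk0
    nlinarith

end TwoSetup

end Summit.ABC.StewartYu

end
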